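import Literature.Analysis.FluidPDE.NSEnstrophyBalance2DProofs
import Literature.Analysis.FluidPDE.AlexakisDoeringProofs
import Literature.Analysis.FluidPDE.TorusClassicalLerayHopfProofs
import Literature.Analysis.FluidPDE.LongTimeAverageSlidingWindow

/-!
# G3 `stub_shellEnstrophyBound`: the single-shell enstrophy bound `⟨‖∇v‖²⟩ ≤ λE`

Registered tool stub of the line `Sketch` (duhamel-release) for the crux
`Summit.AnomalousDissipation.AnomalousDissipation.Theses.TwoAndHalfD.TwohalfdThesis`
(stmt-AnomalousDissipation-0206); the statement is registered verbatim on the item.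

CONTENT (Alexakis–Doering 2006, §4; Marchioro 1986). Let `(v, p)` be a classical solution of the
planar Navier–Stokes equations on `[0, ∞) × 𝕋²` with viscosity `ν > 0` and a steady smooth
divergence-free mean-zero force `g` which is a Stokes eigenfield, `Δg = -λg` (`λ > 0`), and
suppose the pointwise energy bound `∫‖v(t)‖² ≤ E` for `t ≥ 0`. Then the honest `limsup` long-time
mean of the (spectral) enstrophy `‖∇v(t)‖₂²` is at most `λE`.

PROOF. All estimates are at finite `T > 0`; write `Z_T`, `P_T` for the running means of
`‖∇v‖₂²`, `‖Δv‖₂²` on `[0, T]`.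
(i) The classical solution is a global Leray–Hopf solution with datum `v 0`
(`IsClassicalNSSolutionOn.isLerayHopfOn_of_convex`), the datum is smooth hence in `V`, so the
tree's enstrophy balance (`fmrt_enstrophy_balance_torus2_holds`) gives
`½‖∇v(T)‖² + ν T P_T = ½‖∇v(0)‖² - ∫₀ᵀ∫⟪Δg, v⟫ = ½‖∇v(0)‖² + λ∫₀ᵀ∫⟪g, v⟫` (eigen relation
inside the pairing).
(ii) The classical energy equality (`IsClassicalNSSolutionOn.energy_eq`, the classical
`‖∇·‖₂²` being the spectral one on smooth slices) gives
`∫₀ᵀ∫⟪g, v⟫ = ½‖v(T)‖² - ½‖v(0)‖² + ν T Z_T ≤ E/2 + ν T Z_T`.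
(iii) The spectral interpolation `‖∇v‖⁴ ≤ ‖v‖²‖Δv‖²` (`toReal_eGradNormSq_sq_le`) and
Cauchy–Schwarz in time (`timeMean_le_sqrt_timeMean_mul_timeMean`) give `Z_T² ≤ E P_T`.
(iv) Hence `ν T (Z_T² - λE Z_T) ≤ E(‖∇v(0)‖² + λE)/2 =: C` for every `T > 0`; so for `δ > 0` and
`T ≥ C/(νδ²) + 1` one has `Z_T ≤ λE + δ` (otherwise `Z_T² - λE Z_T > δ²`), and
`longTimeAvgSup_le_of_eventually_le` + `le_of_forall_pos_le_add` conclude.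
Supports stmt-AnomalousDissipation-0206. [cite: AlexakisDoering2006PLA, §4]
-/

noncomputable section

-- the summit path `AnomalousDissipation/AnomalousDissipation` duplicates a namespace component
set_option linter.dupNamespace false

namespace Summit.AnomalousDissipation.AnomalousDissipation.Theorems.TwohalfdThesis

open MeasureTheory Set Filter Topology
open scoped ENNReal NNReal InnerProductSpace
open Literature.Analysis.FunctionSpaces Literature.Analysis.FluidPDE

/-- Elementary real-variable step of the single-shell bound: if `z ≥ 0` satisfies
`ν T (z² - λE z) ≤ C` in the form `ν T z² ≤ C + λE ν T z` with `ν, T > 0`, `λE ≥ 0`, `δ > 0`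
and `C < ν T δ²`, then `z ≤ λE + δ` (otherwise `z > λE + δ > 0` and
`z² - λE z - δ² = (z - λE - δ)(z + δ) + λE δ > 0`, so `ν T δ² < ν T (z² - λE z) ≤ C`). [folklore] -/
theorem le_add_of_mul_sq_le {ν T z m δ C : ℝ} (hν : 0 < ν) (hT : 0 < T) (hm : 0 ≤ m)
    (hδ : 0 < δ) (h : ν * T * z ^ 2 ≤ C + m * (ν * T) * z)
    (hC : C < ν * T * δ ^ 2) : z ≤ m + δ := by
  refine le_of_not_gt fun hcon => ?_
  have h1 : δ ^ 2 < z ^ 2 - m * z := by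
    nlinarith [mul_pos (sub_pos.2 hcon) (by linarith : 0 < z + δ), mul_nonneg hm hδ.le]
  have h2 : ν * T * δ ^ 2 < ν * T * (z ^ 2 - m * z) := mul_lt_mul_of_pos_left h1 (by positivity)
  have h3 : ν * T * (z ^ 2 - m * z) = ν * T * z ^ 2 - m * (ν * T) * z := by ring
  linarith

/-- **G3 `stub_shellEnstrophyBound` (line `Sketch` = duhamel-release, crux
`TwoAndHalfD.TwohalfdThesis`): the single-shell enstrophy identity** (Alexakis–Doering 2006 §4,
Marchioro 1986). For a classical solution `(v, p)` of the planar Navier–Stokes system on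
`[0, ∞) × 𝕋²` with viscosity `ν > 0`, steady smooth divergence-free mean-zero force `g` that is
a Stokes eigenfield, `Δg = −λg` (`λ > 0`), and pointwise energy `∫‖v(t)‖² ≤ E` (`t ≥ 0`), the
honest `limsup` long-time mean enstrophy obeys `⟨‖∇v‖²_{L²}⟩ ≤ λ E`: enstrophy balance
(`fmrt_enstrophy_balance_torus2_holds` for the global Leray–Hopf solution the classical one is)
with the eigen relation in the pairing, the classical energy equality
(`IsClassicalNSSolutionOn.energy_eq`), the spectral interpolation `‖∇v‖⁴ ≤ ‖v‖²‖Δv‖²` with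
Cauchy–Schwarz in time, and the elementary step `le_add_of_mul_sq_le`. [cite: AlexakisDoering2006PLA, §4] -/
theorem stub_shellEnstrophyBound :
    ∀ (ν lam E : ℝ) (g : (UnitAddTorus (Fin 2)) → (EuclideanSpace ℝ (Fin 2))) (v : ℝ → (UnitAddTorus (Fin 2)) → (EuclideanSpace ℝ (Fin 2))) (p : ℝ → (UnitAddTorus (Fin 2)) → ℝ),
      0 < ν → 0 < lam → Torus.IsSmooth g → Torus.IsDivFree g → Torus.HasZeroMean g →
      (∀ x, Torus.laplacian g x = -(lam • g x)) →
      Torus.IsClassicalNSSolutionOn (Ici 0) ν (fun _ => g) v p →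
      (∀ t, 0 ≤ t → ∫ x, ‖v t x‖ ^ 2 ≤ E) →
      longTimeAvgSup (fun t => (Torus.eGradNormSq (v t)).toReal) ≤ lam * E := by
  intro ν lam E g v p hν hlam hg hgdiv hgmean heig hNS hE
  -- (0) the classical solution is a global Leray–Hopf solution with smooth datum `v 0`
  have hLH : Torus.IsGlobalLerayHopf ν (fun _ => g) (v 0) v :=
    fun T hT => hNS.isLerayHopfOn_of_convex (convex_Ici 0) hT Icc_subset_Ici_self
  have hu := hNS.smooth_velocity
  have hsm : ∀ t, 0 ≤ t → Torus.IsSmooth (v t) := fun t ht => hu.isSmooth_slice (mem_Ici.2 ht)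
  have hV0 : Torus.MemSobolev 1 (EuclideanSpace.complexify ∘ v 0) :=
    (hsm 0 le_rfl).memSobolev_one_complexify
  obtain ⟨hreg, hbal⟩ :=
    fmrt_enstrophy_balance_torus2_holds hν hg hgdiv hgmean hV0 hLH.isWeaklyDivFree_datum hLH
  -- notation
  set Z : ℝ → ℝ := fun t => (Torus.eGradNormSq (v t)).toReal with hZdef
  set P : ℝ → ℝ := fun t => (eLaplacianNormSq (v t)).toReal with hPdef
  set En : ℝ → ℝ := fun t => ∫ x, ‖v t x‖ ^ 2 with hEndef
  set G₀ : ℝ := (Torus.eGradNormSq (v 0)).toReal with hG₀def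
  have hZ0 : ∀ t, 0 ≤ Z t := fun t => ENNReal.toReal_nonneg
  have hP0 : ∀ t, 0 ≤ P t := fun t => ENNReal.toReal_nonneg
  have hEn0 : ∀ t, 0 ≤ En t := fun t => integral_nonneg fun _ => sq_nonneg _
  have hG₀0 : 0 ≤ G₀ := ENNReal.toReal_nonneg
  have hE0 : 0 ≤ E := (hEn0 0).trans (hE 0 le_rfl)
  have hlamE : 0 ≤ lam * E := mul_nonneg hlam.le hE0
  -- running means versus integrals over `(0, T]`
  have hIoc : ∀ (F : ℝ → ℝ) {T : ℝ}, 0 < T → ∫ s in Ioc 0 T, F s = T * timeMean F T := by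
    intro F T hT
    rw [timeMean, intervalIntegral.integral_of_le hT.le, ← mul_assoc, mul_inv_cancel₀ hT.ne',
      one_mul]
  -- (i) the eigen relation inside the force pairing: `∫⟪Δg, v(s)⟫ = -λ ∫⟪g, v(s)⟫`
  have hpair : ∀ s, (∫ x, ⟪Torus.laplacian g x, v s x⟫_ℝ) = -lam * ∫ x, ⟪g x, v s x⟫_ℝ := by
    intro s
    rw [← integral_const_mul]
    refine integral_congr_ae (ae_of_all _ fun x => ?_)
    show ⟪Torus.laplacian g x, v s x⟫_ℝ = -lam * ⟪g x, v s x⟫_ℝ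
    rw [heig x, inner_neg_left, real_inner_smul_left]
    ring
  -- (ii) the energy equality in the form `∫₀ᵀ∫⟪g, v⟫ ≤ E/2 + ν T Z_T`
  have hforce : ∀ {T : ℝ}, 0 < T →
      (∫ s in Ioc 0 T, ∫ x, ⟪g x, v s x⟫_ℝ) ≤ 2⁻¹ * E + ν * (T * timeMean Z T) := by
    intro T hT
    have hen : Torus.kineticEnergy (v T) + ν * ∫ τ in (0 : ℝ)..T, Torus.gradNormSq (v τ) =
        Torus.kineticEnergy (v 0) + ∫ τ in (0 : ℝ)..T, ∫ x, ⟪g x, v τ x⟫_ℝ :=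
      hNS.energy_eq (convex_Ici 0) hT.le Icc_subset_Ici_self
    have hgrad : ∫ τ in (0 : ℝ)..T, Torus.gradNormSq (v τ) = T * timeMean Z T := by
      rw [intervalIntegral.integral_of_le hT.le, ← hIoc Z hT]
      refine setIntegral_congr_fun measurableSet_Ioc fun τ hτ => ?_
      simp only [hZdef]
      rw [Torus.eGradNormSq_eq_ofReal_gradNormSq (hsm τ hτ.1.le),
        ENNReal.toReal_ofReal (Torus.gradNormSq_nonneg _)]
    rw [hgrad, intervalIntegral.integral_of_le hT.le] at hen
    have hKT : Torus.kineticEnergy (v T) ≤ 2⁻¹ * E :=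
      mul_le_mul_of_nonneg_left (hE T hT.le) (by norm_num)
    have hK0 : 0 ≤ Torus.kineticEnergy (v 0) := Torus.kineticEnergy_nonneg _
    linarith
  -- (i)+(ii): `ν T P_T ≤ G₀/2 + λ (E/2 + ν T Z_T)`
  have hpal : ∀ {T : ℝ}, 0 < T →
      ν * (T * timeMean P T) ≤ 2⁻¹ * G₀ + lam * (2⁻¹ * E + ν * (T * timeMean Z T)) := by
    intro T hT
    have hb := hbal T hT
    have hlap : (∫ s in Ioc 0 T, ∫ x, ⟪Torus.laplacian g x, v s x⟫_ℝ) =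
        -lam * ∫ s in Ioc 0 T, ∫ x, ⟪g x, v s x⟫_ℝ := by
      rw [← integral_const_mul]
      exact integral_congr_ae (ae_of_all _ fun s => hpair s)
    rw [hlap, hIoc P hT] at hb
    have hf := mul_le_mul_of_nonneg_left (hforce hT) hlam.le
    have hZT : 0 ≤ 2⁻¹ * (Torus.eGradNormSq (v T)).toReal := by positivity
    linarith
  -- (iii) interpolation and Cauchy–Schwarz in time: `Z_T² ≤ E P_T`
  have hCS : ∀ {T : ℝ}, 0 < T → timeMean Z T ^ 2 ≤ E * timeMean P T := by
    intro T hT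
    have hsub : Ioc (0 : ℝ) T ⊆ Ioi 0 := Ioc_subset_Ioi_self
    have hH2 := ae_restrict_of_ae_restrict_of_subset hsub (hLH.ae_eLaplacianNormSq_ne_top hreg)
    have hGEL : ∀ᵐ t ∂(volume.restrict (Ioc 0 T)), Z t ^ 2 ≤ En t * P t := by
      filter_upwards [hH2, ae_restrict_mem measurableSet_Ioc] with t ht htm
      exact toReal_eGradNormSq_sq_le (hLH.memLp_two htm.1.le) ht
    have hZm : AEStronglyMeasurable Z (volume.restrict (Ioc 0 T)) :=
      hLH.aestronglyMeasurable_toReal_eGradNormSq.mono_measure (Measure.restrict_mono hsub le_rfl)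
    have h1 := timeMean_le_sqrt_timeMean_mul_timeMean hT (ae_of_all _ fun t => hZ0 t)
      (ae_of_all _ fun t => hEn0 t) (ae_of_all _ fun t => hP0 t) hGEL hZm
      (hLH.integrableOn_integral_norm_sq hT)
      ((hLH T hT).integrableOn_toReal_eLaplacianNormSq (hreg T hT))
    have hEnT : timeMean En T ≤ E := by
      have h := timeMean_le_timeMean_of_nonneg_of_le (D := En) (B := fun _ => E) hT.le
        (fun s _ => hEn0 s) (fun s hs => hE s hs.1.le) (integrableOn_const measure_Ioc_lt_top.ne)
      have hc : timeMean (fun _ => E) T = E := by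
        rw [timeMean, intervalIntegral.integral_const, smul_eq_mul, sub_zero, ← mul_assoc,
          inv_mul_cancel₀ hT.ne', one_mul]
      rwa [hc] at h
    have hPT : 0 ≤ timeMean P T := timeMean_nonneg hP0 hT.le
    have hprod : 0 ≤ timeMean En T * timeMean P T := mul_nonneg (timeMean_nonneg hEn0 hT.le) hPT
    calc timeMean Z T ^ 2 ≤ Real.sqrt (timeMean En T * timeMean P T) ^ 2 :=
          pow_le_pow_left₀ (timeMean_nonneg hZ0 hT.le) h1 2
      _ = timeMean En T * timeMean P T := Real.sq_sqrt hprod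
      _ ≤ E * timeMean P T := mul_le_mul_of_nonneg_right hEnT hPT
  -- (iv) the quadratic inequality `ν T Z_T² ≤ C + λE ν T Z_T`, `C = E (G₀ + λE)/2`
  set C : ℝ := E * (G₀ + lam * E) / 2 with hCdef
  have hquad : ∀ {T : ℝ}, 0 < T →
      ν * T * timeMean Z T ^ 2 ≤ C + lam * E * (ν * T) * timeMean Z T := by
    intro T hT
    have h1 : ν * T * timeMean Z T ^ 2 ≤ E * (ν * (T * timeMean P T)) := by
      have := mul_le_mul_of_nonneg_left (hCS hT) (mul_pos hν hT).le
      linarith [this]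
    have h2 := mul_le_mul_of_nonneg_left (hpal hT) hE0
    have h3 : E * (2⁻¹ * G₀ + lam * (2⁻¹ * E + ν * (T * timeMean Z T))) =
        C + lam * E * (ν * T) * timeMean Z T := by
      simp only [hCdef]; ring
    linarith
  -- conclusion: for every `δ > 0`, eventually `Z_T ≤ λE + δ`
  refine le_of_forall_pos_le_add fun δ hδ => longTimeAvgSup_le_of_eventually_le hZ0 ?_
  filter_upwards [eventually_ge_atTop (C / (ν * δ ^ 2) + 1)] with T hT
  have hνδ : 0 < ν * δ ^ 2 := by positivity
  have hC0 : 0 ≤ C := by positivity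
  have hTpos : 0 < T := lt_of_lt_of_le (by positivity) hT
  have hClt : C < ν * T * δ ^ 2 := by
    have h1 : C / (ν * δ ^ 2) < T := by linarith
    rw [div_lt_iff₀ hνδ] at h1
    linarith [h1]
  exact le_add_of_mul_sq_le hν hTpos hlamE hδ (hquad hTpos) hClt

end Summit.AnomalousDissipation.AnomalousDissipation.Theorems.TwohalfdThesis

end
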